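import Summits.AtomisticToContinuum.HydrodynamicLimit.Theses.AdiabaticParcels

/-!
# Birth skeleton — crux `MomentumLimit` (stmt-AtomisticToContinuum-17400)

Route `AdiabaticParcels` (AtomisticToContinuum / HydrodynamicLimit), target crux (rank 0):
`Summit.AtomisticToContinuum.HydrodynamicLimit.Theses.AdiabaticParcels.MomentumLimit` — the
PACKING-GUARDED momentum limit: `∃ η₀ > 0` such that for continuous local-equilibrium profiles
`∃ σ₀ ∀ σ < σ₀`, for every classical hard-sphere-Euler solution `(ρ,u,θ)` on `[0,T)` whose local
packing fraction stays below `η₀`, every family of hard-sphere flows `Φ N` with probability local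
Gibbs laws whose empirical fields converge at `t = 0`, the empirical MOMENTUM field tested against
every continuous `χ` converges in probability to `∫ χ ρ_t u_t` at every `t < T`.

## The line (the route's own layer-2 plan for the target, typed: "Euler is kinematics — Lagrangian
parcels are closed adiabatic pistons")

The route reaches its target `X = MomentumLimit` through the PISTON DEVICE (route header § Two-layer
plan; support item `MomentumViaPistons`, stmt-AtomisticToContinuum-14522):

* `stub_eulerFlowMapExists` (= route support `EulerFlowMapExists`, stmt-14710, M): the classical
  Euler velocity `u` has a Lagrangian flow map `Xt` on `[0,T)` (`Torus.IsFlowMapOn`).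
* `stub_pistonFlowExists` (= route support `PistonFlowExists`, stmt-14318, L): for all large `N` the
  PISTON GAS — the same `N+1` spheres plus massless specular walls on the faces of the
  `⌊(N+1)^a⌋`-grid transported by `Xt` — has an a.e. flow (`MovingWallHardSphereFlow` is inhabited).
* `stub_walledLocalGibbsLLN` (= route support `WalledLocalGibbsLLN`, stmt-14711, L): the local Gibbs
  law restricted to the time-0 walled domain is eventually a probability measure and inherits the
  time-0 law of large numbers of the free local Gibbs fields (excluded slabs have vanishing volume).
* `stub_pistonCellAdiabat` (= route crux `PistonCellAdiabat`, stmt-14320, rank 5, XL): the Kasuga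
  rung — each closed deforming cell of the piston gas equilibrates on its (energy, momentum) shell
  fast enough that the piston-gas fields follow `(ρ, ρu, E)(t)` on `[0,T']` (thermalisation WITH A
  RATE; the hardest stub).
* `stub_wallTransparency` (= route crux `WallTransparency`, stmt-14319, rank 4, XL): in the
  mesoscopic window `a ∈ (1/6, 1/3)` the walls are transparent in law — if the piston gas follows
  `(ρ, ρu, E)` on `[0,T']` then so does the FREE gas.

`MomentumLimit_of`: pure logic over the five stubs, and NOT a one-line seam (it is verbatim a proof
of the support item `MomentumViaPistons`, exposed here as `momentumViaPistons`): `η₀ := 1` (the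
stubs are unguarded, so the guarded target follows a fortiori — the guard hypothesis is discarded);
for profiles `σ₀ := min (min σ_WT σ_PCA) (min σ_WLLN 2⁻¹)`; for `σ < σ₀`, a solution on `[0,T)`, free
flows `Φ` with probability local Gibbs laws and converging time-0 fields, and `t ∈ [0,T)`: exponent
`a := 1/4`, horizon `T' := t`; `Xt` from `stub_eulerFlowMapExists` (`Xt 0 = id` is the first clause
of `Torus.IsFlowMapOn`); `N₁` and the piston flows `Ψ N h := (… N h).some` from
`stub_pistonFlowExists`; eventual probability of the walled law and its time-0 LLN from
`stub_walledLocalGibbsLLN`; the cell histories from `stub_pistonCellAdiabat`; all three free-gas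
fields at `t` from `stub_wallTransparency` (at `t ∈ Icc 0 t`); keep the momentum component (`.2.1`
of `TendstoHydroFieldsAt`). The `let`-bound grid / walls / walled law / `Conv` of the three walled
items are syntactically identical, so the instantiated hypotheses match by ζβ-conversion.

## Hardest stub, evidence honoured

Hardest: `stub_pistonCellAdiabat` (no mixing RATE is known for `n ≥ 3` hard balls in a box —
Simanyi; Fermi acceleration at moving walls — Gelfreich–Rom-Kedar–Turaev), then
`stub_wallTransparency` (no law-level stability theorem comparing two chaotic `N`-body billiards).
No `Disproof.lean` exists for this crux at registration (`ledger crux ls`: no workfiles), so there is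
no `_false_without_` obstruction to honour yet; `ledger negatives --problem AtomisticToContinuum`
(20 entries, 2026-08-17) contains no statement of route AdiabaticParcels and none of the five stubs
is an instance of a refuted statement (the HydrodynamicLimit negatives are Enskog test families,
warm/cold cell dichotomies, clamped-window LD at equilibrium, contact-intensity domination, Lanford
envelope, exp-tail budget, spectral contraction, Anosov dice). No stub restates the crux or the
conjunct: each walled stub speaks about the PISTON gas or about existence / time-0 data only, and
the BC3 probes `stub → MomentumLimit`, `stub → HydrodynamicLimit` by
`first | exact? | simpa | aesop` fail for all five (registrar's probe file, quoted in `birth.md`).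

Sources: Spohn1991 Part I Ch. 3; Kasuga1961; NeishtadtSinai2004; Wright2007; ChernovLebowitzSinai2002;
Simanyi1999; GelfreichRomkedarTuraev2013; Alexander1975; Ruelle1969 §3.4 (as on the route items).
-/

namespace Summit.AtomisticToContinuum.HydrodynamicLimit.Cruxes.MomentumLimit.Birth

open Summit.AtomisticToContinuum.HydrodynamicLimit.Theses.AdiabaticParcels
open MeasureTheory Filter Set
open Literature.MathematicalPhysics.KineticTheory

/-! ## The five stubs (the route's layer-2 antecedents of the target, BY NAME) -/

/-- STUB 1 (hardest; = route crux `PistonCellAdiabat`, stmt-AtomisticToContinuum-14320): the Kasuga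
rung in its honest window — the fields of the PISTON gas (closed cells of the transported
`⌊(N+1)^a⌋`-grid, `a ∈ (1/6,1/3)`, started from the walled local Gibbs law) follow `(ρ, ρu, E)(t)`
on `[0,T']`, for piston flows given from some `N₁` on. -/
theorem stub_pistonCellAdiabat : PistonCellAdiabat := by
  sorry

/-- STUB 2 (= route crux `WallTransparency`, stmt-AtomisticToContinuum-14319): wall transparency in
law in the mesoscopic window — if the piston gas follows `(ρ, ρu, E)` on `[0,T']`, so does the free
gas started from the same local Gibbs law. -/
theorem stub_wallTransparency : WallTransparency := by
  sorry

/-- STUB 3 (= route support `PistonFlowExists`, stmt-AtomisticToContinuum-14318): for all large `N`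
the moving-wall hard-sphere flow of the piston gas exists (the structure is inhabited). -/
theorem stub_pistonFlowExists : PistonFlowExists := by
  sorry

/-- STUB 4 (= route support `EulerFlowMapExists`, stmt-AtomisticToContinuum-14710): the Lagrangian
flow map of the classical Euler velocity exists on `[0,T)`. -/
theorem stub_eulerFlowMapExists : EulerFlowMapExists := by
  sorry

/-- STUB 5 (= route support `WalledLocalGibbsLLN`, stmt-AtomisticToContinuum-14711): the walled
local Gibbs law is eventually a probability measure and inherits the time-0 LLN of the free fields. -/
theorem stub_walledLocalGibbsLLN : WalledLocalGibbsLLN := by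
  sorry

/-! ## The composition -/

/-- THE PISTON GLUE, proved (verbatim the route's support item `MomentumViaPistons`,
stmt-AtomisticToContinuum-14522: `PistonCellAdiabat → WallTransparency → PistonFlowExists →
EulerFlowMapExists → WalledLocalGibbsLLN → MomentumLimit`). Pure logic; see the module docstring
for the choices (`η₀ := 1`, `a := 1/4`, `T' := t`, `Ψ N h := (… N h).some`). -/
theorem momentumViaPistons : MomentumViaPistons := by
  intro hPCA hWT hPFE hEFM hWLLN
  refine ⟨1, one_pos, ?_⟩
  intro a₀ θ₀ u₀ ha hθ hu ha0 hθ0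
  obtain ⟨σ₁, hσ₁, H1⟩ := hWT a₀ θ₀ u₀ ha hθ hu ha0 hθ0
  obtain ⟨σ₂, hσ₂, H2⟩ := hPCA a₀ θ₀ u₀ ha hθ hu ha0 hθ0
  obtain ⟨σ₃, hσ₃, H3⟩ := hWLLN a₀ θ₀ u₀ ha hθ hu ha0 hθ0
  refine ⟨min (min σ₁ σ₂) (min σ₃ 2⁻¹), lt_min (lt_min hσ₁ hσ₂) (lt_min hσ₃ (by norm_num)), ?_⟩
  intro σ hσ hσlt T ρ θ u hE _hGuard Φ hP h0 t ht
  have h1 : σ < σ₁ := lt_of_lt_of_le hσlt ((min_le_left _ _).trans (min_le_left _ _))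
  have h2 : σ < σ₂ := lt_of_lt_of_le hσlt ((min_le_left _ _).trans (min_le_right _ _))
  have h3 : σ < σ₃ := lt_of_lt_of_le hσlt ((min_le_right _ _).trans (min_le_left _ _))
  have h4 : σ < 2⁻¹ := lt_of_lt_of_le hσlt ((min_le_right _ _).trans (min_le_right _ _))
  have ha1 : (1 : ℝ) / 6 < 1 / 4 := by norm_num
  have ha2 : (1 : ℝ) / 4 < 1 / 3 := by norm_num
  have ha0' : (0 : ℝ) < 1 / 4 := by norm_num
  have htT : t < T := ht.2
  -- the Lagrangian flow map of `u`
  obtain ⟨Xt, hXt⟩ := hEFM σ T ρ θ u hE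
  have hX0 : ∀ x, Xt 0 x = x := fun x => (hXt x).1
  -- the piston-gas flows, from `N₁` on
  obtain ⟨N₁, hN₁⟩ := hPFE σ hσ h4 (1 / 4) ha0' ha2 T ρ θ u hE Xt hXt t htT
  -- the walled local Gibbs law: eventually a probability measure, time-0 LLN
  obtain ⟨hPN, hC0⟩ := H3 σ hσ h3 (1 / 4) ha0' ha2 ρ θ u Xt hX0 Φ h0
  -- the cells follow Euler (piston gas)
  have hcells := H2 σ hσ h2 (1 / 4) ha1 ha2 T ρ θ u hE Xt hXt t htT N₁ (fun N h => (hN₁ N h).some)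
    hPN hC0
  -- the walls are transparent: the free gas follows Euler at `t`
  have hfree := H1 σ hσ h1 (1 / 4) ha1 ha2 T ρ θ u hE Xt hXt t htT Φ N₁ (fun N h => (hN₁ N h).some)
    hP hPN h0 hC0 hcells t ⟨ht.1, le_rfl⟩
  -- keep the momentum component
  intro χ hχ δ hδ
  exact (hfree χ hχ δ hδ).2.1

/-- THE SKELETON THEOREM: the target crux `MomentumLimit` BY NAME from the five declared stubs. -/
theorem MomentumLimit_of :
    Summit.AtomisticToContinuum.HydrodynamicLimit.Theses.AdiabaticParcels.MomentumLimit :=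
  momentumViaPistons stub_pistonCellAdiabat stub_wallTransparency stub_pistonFlowExists
    stub_eulerFlowMapExists stub_walledLocalGibbsLLN

end Summit.AtomisticToContinuum.HydrodynamicLimit.Cruxes.MomentumLimit.Birth
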